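/-
Copyright (c) 2026 the pub-hodgecm-mathlib formalisation cell (harness21).  Prover seat hodgecm-mathlib-K2E3-p21 (g6), Track B «K2-LIT» ∕ h413
(`stmt-HodgeConjecture-24833`), line `K2_E3_EllipticInputs`, leaf (nsc-S-A′), H-layer brick LEV-1 of `MEMO-H4-residues.v1.K2E3-p25-g0.md` §1 (architect K2E3-p25 (g0);
dealer K2E3-plan (g4) RULINGS #2 (R-6) D76; split with K2E3-p17 (g8) 2026-09-04T09:38Z: LEV-1 here, LEV-2∕LEV-3 his).  2026-09-04.
-/
import Literature.NumberTheory.Automorphic.WhittakerTwistedJacquet      -- ★ `Representation.IsSmooth`, `Representation.twist`, `stabilizerSubgroup`, coinvariant exactness pattern (finite averaging)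
import Mathlib.Analysis.Fourier.FiniteAbelian.PontryaginDuality          -- `AddChar.sum_apply_eq_ite`, `AddChar.sum_eq_ite`, `AddChar.instFintype`
import HarnessLib

/-!
# Crux `H413` — K2-LIT E3, H-layer brick LEV-1: SEPARATION BY TWISTED COINVARIANTS on an abelian group exhausted by compact open subgroups

Cell `hodgecm-mathlib`, Track B, line `K2_E3_EllipticInputs`, leaf (nsc-S-A′) `sig_K2E3GL3PrincipalBlockStandardSpan`, H-layer residue R2 (architect K2E3-p25 (g0),
`MEMO-H4-residues.v1` §1: rule (lev) = LEV-3 `K2E3GL3DegenerateLevelOne` over LEV-1 (this file) and LEV-2 `K2E3CoinvariantsInStages`).  THEOREMS ONLY; count-neutral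
helper (`--supports stmt-HodgeConjecture-24833 --as helper`); no `def` ∕ `instance` ∕ `notation` ∕ named fact.
THE STATEMENT (LEMMA L1 of the memo).  `N` an ABELIAN topological group exhausted by compact open subgroups `K₀ ≤ K₁ ≤ ⋯` (e.g. a root subgroup `F` or `F²` of `GL₃(F)`,
`Kₙ = ϖ⁻ⁿ𝒪`), `τ` a SMOOTH representation of `N` on a complex vector space, `v` a vector dying in the `ψ`-twisted coinvariants `V ⧸ V(N, ψ)`,
`V(N, ψ) = ⟨ψ(n)⁻¹τ(n)x − x⟩ = Coinvariants.ker (τ.twist ψ⁻¹)` (the `θ`-localisation of Bernstein–Zelevinsky) for EVERY character `ψ : N → ℂ^×` with open kernel ⟹ `v = 0`.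
No Pontryagin duality for `N` is used — only for the FINITE abelian quotients `Kₙ ⧸ S`, `S := K₀ ∩ Stab(v)` (Mathlib `AddChar.sum_apply_eq_ite`, `AddChar.sum_eq_ite`).
PROOF (memo §1; dependent choice replaces König since the restriction maps are onto), with `E_{n,χ} w := ∑_{q ∈ Kₙ⧸S} χ(q)⁻¹ τ(q̃) w` for `χ` a character of `Kₙ ⧸ S`:
* §1 (algebra, any commutative group) `twistedSum_translate` (`E(τ(m)w) = c(m)·E w`, twisted twin of ★ `sum_quotient_out_hom_apply_apply`), `twistedSum_sub_eq_zero`,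
  `sum_addChar_twistedSum_eq_card_smul` (COMPLETENESS `∑_χ E_{n,χ} w = |Kₙ⧸S|·w`), `exists_addChar_extension` (ORTHOGONALITY IN STAGES: `E_{n,χ} v ≠ 0` forces a
  character `χ′` of `Kₘ ⧸ S` extending `χ` with `E_{m,χ′} v ≠ 0`).
* §2 `exists_twistedSum_eq_zero_of_mem_ker` — the JACQUET–LANGLANDS LEMMA in this currency: `v ∈ V(N, ψ)`, `ψ|_S = 1` ⟹ `E_{m,ψ} v = 0` for some `m` (the finite-averaging
  argument of ★ `Representation.coinvariantsMap_injective_of_isLimitOfCompactOpen`).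
* §3 **`eq_zero_of_forall_mem_ker_coinvariants_twist`** (the head): `χ₀` with `E_{0,χ₀} v ≠ 0` (completeness), a compatible thread `(χₙ)` (§1), glued to a character `ψ`
  of `N = ⋃ Kₙ` with `S ≤ Ker ψ` open; the hypothesis gives `v ∈ V(N, ψ)` and §2 gives `E_{m,χₘ} v = 0` — contradiction.
* §4 corollaries in the consumers' frames: `…_of_comm` (a `Group` with a commutativity hypothesis) and **`eq_zero_of_forall_mem_ker_charTwist`** (an abelian subgroup
  `U ≤ G`, `ρ` smooth on `G`, the `θ`-localisations `(ρ.charTwist U θ).Coinvariants` of ★ `WhittakerTwistedJacquet`) — the shape rule (lev) uses for root subgroups.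

HONEST LABEL: HC_CM is proved only modulo the 7 printed citations (2 remaining named inputs: hLiu418 = stmt-HodgeConjecture-24832, h413 =
stmt-HodgeConjecture-24833) until rung 0 closes; elementary, closes no organ by itself (LEV-3 consumes it for the H-layer of (nsc-S-A′)).

## References
* [BernsteinZelevinsky1976] I. N. Bernstein, A. V. Zelevinsky, *Representations of the group GL(n,F) where F is a non-archimedean local field*, Russian Math.
  Surveys 31:3 (1976), §2.30–§2.36 (the functor `r_{U,θ}`, Jacquet–Langlands' lemma 2.33, exactness 2.35).
* [BernsteinZelevinskyASENS1977] I. N. Bernstein, A. V. Zelevinsky, *Induced representations of reductive p-adic groups I*, Ann. Sci. ÉNS 10 (1977), §1.8–1.9.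
* [Bump1997] D. Bump, *Automorphic Forms and Representations* (1997), §4.4, Prop. 4.4.1–4.4.3 p. 462 (the Jacquet–Langlands lemma `v ∈ V(N,ψ) ⇔ ∫_K ψ̄ τ v = 0`).
-/

set_option autoImplicit false
-- the mandated namespace repeats `HodgeConjecture.HodgeConjecture`, as in every `Theorems/*.lean` of this sub-problem
set_option linter.dupNamespace false

noncomputable section

open Representation

namespace Summit.HodgeConjecture.HodgeConjecture.Cruxes.H413.K2E3TwistedCoinvariantsSeparation

variable {N : Type*} [CommGroup N] {V : Type*} [AddCommGroup V] [Module ℂ V] (τ : Representation ℂ N V)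

/-! ## §1  Twisted finite averages over `H ⧸ T` (any commutative group) -/

section Algebra

variable {H : Subgroup N} (T : Subgroup ↥H) [Fintype (↥H ⧸ T)]

omit [Fintype (↥H ⧸ T)] in
/-- A multiplicative `c : H → ℂ` which is `1` on a subgroup never vanishes (`c x · c x⁻¹ = c 1 = 1`). [folklore] -/
theorem mulFun_ne_zero (c : ↥H → ℂ) (hc : ∀ x y, c (x * y) = c x * c y) (hc1 : ∀ t ∈ T, c t = 1) (x : ↥H) : c x ≠ 0 := by
  intro h0
  have h := hc x x⁻¹
  rw [mul_inv_cancel, hc1 1 T.one_mem, h0, zero_mul] at h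
  exact one_ne_zero h

/-- **TWISTED TRANSLATION** (twisted twin of ★ `Representation.sum_quotient_out_hom_apply_apply`): `c : H → ℂ` multiplicative, trivial on `T`, `w` fixed by `T` ⟹ the
twisted average `A w = ∑_{q ∈ H⧸T} c(q̃)⁻¹ τ(q̃) w` has `A (τ(m) w) = c(m) · A w` (re-index `q ↦ q·[m]`; the defect lies in `T`). [cite: BernsteinZelevinsky1976, §2.33] -/
theorem twistedSum_translate (c : ↥H → ℂ) (hc : ∀ x y, c (x * y) = c x * c y) (hc1 : ∀ t ∈ T, c t = 1)
    {w : V} (hT : ∀ t ∈ T, τ ((t : ↥H) : N) w = w) (m : ↥H) :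
    ∑ q : ↥H ⧸ T, (c q.out)⁻¹ • τ ((q.out : ↥H) : N) (τ ((m : ↥H) : N) w) = c m • ∑ q : ↥H ⧸ T, (c q.out)⁻¹ • τ ((q.out : ↥H) : N) w := by
  have hcm : c m ≠ 0 := mulFun_ne_zero T c hc hc1 m
  have key : ∀ q : ↥H ⧸ T, (c q.out)⁻¹ • τ ((q.out : ↥H) : N) (τ ((m : ↥H) : N) w) =
      c m • ((c (q * QuotientGroup.mk m).out)⁻¹ • τ (((q * QuotientGroup.mk m).out : ↥H) : N) w) := by
    intro q
    have hcq : c (q * QuotientGroup.mk m).out ≠ 0 := mulFun_ne_zero T c hc hc1 _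
    obtain ⟨t, ht⟩ := QuotientGroup.mk_out_eq_mul T (q.out * m)
    have hq : (QuotientGroup.mk (q.out * m) : ↥H ⧸ T) = q * QuotientGroup.mk m := by
      rw [QuotientGroup.mk_mul, QuotientGroup.out_eq']
    rw [← hq, ht] at hcq ⊢
    rw [Subgroup.coe_mul, Subgroup.coe_mul, map_mul, map_mul, Module.End.mul_apply, Module.End.mul_apply, hT _ t.2, hc, hc, hc1 _ t.2, mul_one, smul_smul]
    rw [hc, hc, hc1 _ t.2, mul_one] at hcq; congr 1; field_simp
  simp_rw [key]; rw [← Finset.smul_sum]; congr 1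
  exact Fintype.sum_equiv (Equiv.mulRight (QuotientGroup.mk m : ↥H ⧸ T)) _ _ fun _ => rfl

/-- **The twisted average kills the twisted differences** `c(m)⁻¹ τ(m) w − w` (`m ∈ H`, `w` fixed by `T`). [cite: BernsteinZelevinsky1976, §2.33] -/
theorem twistedSum_sub_eq_zero (c : ↥H → ℂ) (hc : ∀ x y, c (x * y) = c x * c y) (hc1 : ∀ t ∈ T, c t = 1)
    {w : V} (hT : ∀ t ∈ T, τ ((t : ↥H) : N) w = w) (m : ↥H) :
    ∑ q : ↥H ⧸ T, (c q.out)⁻¹ • τ ((q.out : ↥H) : N) ((c m)⁻¹ • τ ((m : ↥H) : N) w - w) = 0 := by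
  have hcm : c m ≠ 0 := mulFun_ne_zero T c hc hc1 m
  calc ∑ q : ↥H ⧸ T, (c q.out)⁻¹ • τ ((q.out : ↥H) : N) ((c m)⁻¹ • τ ((m : ↥H) : N) w - w)
      = (c m)⁻¹ • ∑ q : ↥H ⧸ T, (c q.out)⁻¹ • τ ((q.out : ↥H) : N) (τ ((m : ↥H) : N) w) - ∑ q : ↥H ⧸ T, (c q.out)⁻¹ • τ ((q.out : ↥H) : N) w := by
        rw [Finset.smul_sum, ← Finset.sum_sub_distrib]
        refine Finset.sum_congr rfl fun q _ => ?_
        rw [map_sub, map_smul, smul_sub, smul_comm]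
    _ = 0 := by rw [twistedSum_translate τ T c hc hc1 hT m, smul_smul, inv_mul_cancel₀ hcm, one_smul, sub_self]

/-- **COMPLETENESS** over the characters of the finite abelian `H ⧸ T`: `∑_χ ∑_q χ(q)⁻¹ τ(q̃) w = |H ⧸ T|·w` for `w` fixed by `T` (`AddChar.sum_apply_eq_ite`). [cite: Bump1997, §4.4 p. 462] -/
theorem sum_addChar_twistedSum_eq_card_smul {w : V} (hT : ∀ t ∈ T, τ ((t : ↥H) : N) w = w) :
    ∑ χ : AddChar (Additive (↥H ⧸ T)) ℂ, ∑ q : ↥H ⧸ T, (χ (Additive.ofMul (QuotientGroup.mk q.out : ↥H ⧸ T)))⁻¹ • τ ((q.out : ↥H) : N) w =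
      (Fintype.card (↥H ⧸ T) : ℂ) • w := by
  classical
  rw [Finset.sum_comm]
  have hval : ∀ q : ↥H ⧸ T, ∑ χ : AddChar (Additive (↥H ⧸ T)) ℂ, (χ (Additive.ofMul (QuotientGroup.mk q.out : ↥H ⧸ T)))⁻¹ • τ ((q.out : ↥H) : N) w =
      (if q = 1 then (Fintype.card (↥H ⧸ T) : ℂ) else 0) • τ ((q.out : ↥H) : N) w := by
    intro q
    rw [← Finset.sum_smul]; congr 1
    simp_rw [QuotientGroup.out_eq', ← AddChar.map_neg_eq_inv, ← ofMul_inv]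
    rw [AddChar.sum_apply_eq_ite, Fintype.card_additive]
    by_cases hq : q = 1
    · rw [if_pos (by rw [ofMul_eq_zero, hq, inv_one]), if_pos hq]
    · rw [if_neg (by rwa [ofMul_eq_zero, inv_eq_one]), if_neg hq]
  simp_rw [hval]
  rw [Finset.sum_eq_single (1 : ↥H ⧸ T) (fun q _ hq => by rw [if_neg hq, zero_smul]) (fun h => absurd (Finset.mem_univ _) h), if_pos rfl,
    hT _ ((QuotientGroup.eq_one_iff _).1 (QuotientGroup.out_eq' (1 : ↥H ⧸ T)))]

omit [Fintype (↥H ⧸ T)] in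
/-- A twisted average of an `S`-fixed vector is `S`-fixed (`N` is commutative). [folklore] -/
theorem apply_twistedSum_eq_self {ι : Type*} (s : Finset ι) (a : ι → ℂ) (g : ι → N) {w : V} {x : N} (hx : τ x w = w) :
    τ x (∑ i ∈ s, a i • τ (g i) w) = ∑ i ∈ s, a i • τ (g i) w := by
  rw [map_sum]
  refine Finset.sum_congr rfl fun i _ => ?_
  rw [map_smul, ← Module.End.mul_apply, ← map_mul, mul_comm, map_mul, Module.End.mul_apply, hx]

/-- **ORTHOGONALITY IN STAGES ⇒ EXTENSION.**  `H ≤ H'` in the commutative `N`, `v` fixed by `S`: if `E_χ v = ∑_{q ∈ H⧸S} χ(q)⁻¹ τ(q̃) v ≠ 0` for a character `χ` of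
`H ⧸ S`, some character `χ'` of `H' ⧸ S` EXTENDS `χ` with `E_{χ'} v ≠ 0` (`|H'⧸S|·E_χ v = ∑_{χ'} E_{χ'} E_χ v` and `E_{χ'} E_χ v = [χ'|_H = χ]·|H⧸S|·E_{χ'} v`, by twisted
translation and `AddChar.sum_eq_ite` for `χ'|_H − χ`). [cite: Bump1997, §4.4 p. 462] [cite: BernsteinZelevinsky1976, §2.33] -/
theorem exists_addChar_extension {H' S : Subgroup N} (hHH' : H ≤ H')
    [Fintype (↥H ⧸ S.subgroupOf H)] [Fintype (↥H' ⧸ S.subgroupOf H')]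
    {v : V} (hSv : ∀ s ∈ S, τ s v = v) (χ : AddChar (Additive (↥H ⧸ S.subgroupOf H)) ℂ)
    (hχ : ∑ q : ↥H ⧸ S.subgroupOf H, (χ (Additive.ofMul (QuotientGroup.mk q.out : ↥H ⧸ S.subgroupOf H)))⁻¹ • τ ((q.out : ↥H) : N) v ≠ 0) :
    ∃ χ' : AddChar (Additive (↥H' ⧸ S.subgroupOf H')) ℂ,
      (∀ x : ↥H, χ' (Additive.ofMul (QuotientGroup.mk (Subgroup.inclusion hHH' x) : ↥H' ⧸ S.subgroupOf H')) =
        χ (Additive.ofMul (QuotientGroup.mk x : ↥H ⧸ S.subgroupOf H))) ∧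
      ∑ q : ↥H' ⧸ S.subgroupOf H', (χ' (Additive.ofMul (QuotientGroup.mk q.out : ↥H' ⧸ S.subgroupOf H')))⁻¹ • τ ((q.out : ↥H') : N) v ≠ 0 := by
  classical
  have hTv : ∀ t ∈ S.subgroupOf H, τ ((t : ↥H) : N) v = v := fun t ht => hSv _ (Subgroup.mem_subgroupOf.1 ht)
  have hT'v : ∀ t ∈ S.subgroupOf H', τ ((t : ↥H') : N) v = v := fun t ht => hSv _ (Subgroup.mem_subgroupOf.1 ht)
  set w : V := ∑ q : ↥H ⧸ S.subgroupOf H, (χ (Additive.ofMul (QuotientGroup.mk q.out : ↥H ⧸ S.subgroupOf H)))⁻¹ • τ ((q.out : ↥H) : N) v with hw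
  -- `w` is `S`-fixed
  have hT'w : ∀ t ∈ S.subgroupOf H', τ ((t : ↥H') : N) w = w := fun t ht =>
    apply_twistedSum_eq_self τ Finset.univ _ _ (hSv _ (Subgroup.mem_subgroupOf.1 ht))
  -- the map `H ⧸ S → H' ⧸ S` and the pull-back of a character of `H' ⧸ S`
  have hle : S.subgroupOf H ≤ (S.subgroupOf H').comap (Subgroup.inclusion hHH') := by
    intro x hx
    rw [Subgroup.mem_comap, Subgroup.mem_subgroupOf, Subgroup.coe_inclusion]
    exact Subgroup.mem_subgroupOf.1 hx
  set ι : ↥H ⧸ S.subgroupOf H →* ↥H' ⧸ S.subgroupOf H' := QuotientGroup.map (S.subgroupOf H) (S.subgroupOf H') (Subgroup.inclusion hHH') hle with hι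
  have hιmk : ∀ x : ↥H, ι (QuotientGroup.mk x) = QuotientGroup.mk (Subgroup.inclusion hHH' x) :=
    fun x => QuotientGroup.map_mk (S.subgroupOf H) (S.subgroupOf H') _ hle x
  -- each character `χ'` of `H' ⧸ S`: `E_{χ'} w = (∑_a (χ'∘ι − χ)(a)) • E_{χ'} v`
  have hstep : ∀ χ' : AddChar (Additive (↥H' ⧸ S.subgroupOf H')) ℂ,
      ∑ q : ↥H' ⧸ S.subgroupOf H', (χ' (Additive.ofMul (QuotientGroup.mk q.out : ↥H' ⧸ S.subgroupOf H')))⁻¹ • τ ((q.out : ↥H') : N) w =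
        (∑ a : Additive (↥H ⧸ S.subgroupOf H), (χ'.compAddMonoidHom (MonoidHom.toAdditive ι) - χ) a) •
          ∑ q : ↥H' ⧸ S.subgroupOf H', (χ' (Additive.ofMul (QuotientGroup.mk q.out : ↥H' ⧸ S.subgroupOf H')))⁻¹ • τ ((q.out : ↥H') : N) v := by
    intro χ'
    have hc : ∀ x y : ↥H', χ' (Additive.ofMul (QuotientGroup.mk (x * y) : ↥H' ⧸ S.subgroupOf H')) =
        χ' (Additive.ofMul (QuotientGroup.mk x : ↥H' ⧸ S.subgroupOf H')) * χ' (Additive.ofMul (QuotientGroup.mk y : ↥H' ⧸ S.subgroupOf H')) := by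
      intro x y; rw [QuotientGroup.mk_mul, ofMul_mul, AddChar.map_add_eq_mul]
    have hc1 : ∀ t ∈ S.subgroupOf H', χ' (Additive.ofMul (QuotientGroup.mk t : ↥H' ⧸ S.subgroupOf H')) = 1 := by
      intro t ht; rw [(QuotientGroup.eq_one_iff t).2 ht, ofMul_one, AddChar.map_zero_eq_one]
    -- push `E_{χ'}` through the sum defining `w`
    have hpush : ∑ q : ↥H' ⧸ S.subgroupOf H', (χ' (Additive.ofMul (QuotientGroup.mk q.out : ↥H' ⧸ S.subgroupOf H')))⁻¹ • τ ((q.out : ↥H') : N) w =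
        ∑ p : ↥H ⧸ S.subgroupOf H, (χ (Additive.ofMul (QuotientGroup.mk p.out : ↥H ⧸ S.subgroupOf H)))⁻¹ •
          ∑ q : ↥H' ⧸ S.subgroupOf H', (χ' (Additive.ofMul (QuotientGroup.mk q.out : ↥H' ⧸ S.subgroupOf H')))⁻¹ • τ ((q.out : ↥H') : N)
            (τ ((Subgroup.inclusion hHH' p.out : ↥H') : N) v) := by
      rw [hw]; simp only [map_sum, map_smul, Finset.smul_sum]; rw [Finset.sum_comm]
      refine Finset.sum_congr rfl fun p _ => Finset.sum_congr rfl fun q _ => ?_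
      rw [smul_comm, Subgroup.coe_inclusion]
    have htr : ∀ p : ↥H ⧸ S.subgroupOf H,
        ∑ q : ↥H' ⧸ S.subgroupOf H', (χ' (Additive.ofMul (QuotientGroup.mk q.out : ↥H' ⧸ S.subgroupOf H')))⁻¹ • τ ((q.out : ↥H') : N)
            (τ ((Subgroup.inclusion hHH' p.out : ↥H') : N) v) =
          χ' (Additive.ofMul (QuotientGroup.mk (Subgroup.inclusion hHH' p.out) : ↥H' ⧸ S.subgroupOf H')) •
            ∑ q : ↥H' ⧸ S.subgroupOf H', (χ' (Additive.ofMul (QuotientGroup.mk q.out : ↥H' ⧸ S.subgroupOf H')))⁻¹ • τ ((q.out : ↥H') : N) v :=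
      fun p => twistedSum_translate τ (S.subgroupOf H') (fun x : ↥H' => χ' (Additive.ofMul (QuotientGroup.mk x : ↥H' ⧸ S.subgroupOf H'))) hc hc1 hT'v
        (Subgroup.inclusion hHH' p.out)
    rw [hpush]; simp_rw [htr, smul_smul]; rw [← Finset.sum_smul]; congr 1
    -- the scalar: `∑_{p ∈ H⧸S} χ(p)⁻¹ χ'(ι p) = ∑_a (χ'∘ι − χ)(a)`
    refine Fintype.sum_equiv (Additive.ofMul : ↥H ⧸ S.subgroupOf H ≃ Additive (↥H ⧸ S.subgroupOf H)) _ _ fun p => ?_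
    rw [← hιmk, QuotientGroup.out_eq', AddChar.sub_apply, AddChar.map_neg_eq_inv, AddChar.compAddMonoidHom_apply, MonoidHom.toAdditive_apply_apply,
      toMul_ofMul, mul_comm]
  -- completeness at level `H'` for `w`, and the choice of `χ'`
  have hcomp := sum_addChar_twistedSum_eq_card_smul τ (S.subgroupOf H') hT'w
  have hne : ∑ χ' : AddChar (Additive (↥H' ⧸ S.subgroupOf H')) ℂ,
      ∑ q : ↥H' ⧸ S.subgroupOf H', (χ' (Additive.ofMul (QuotientGroup.mk q.out : ↥H' ⧸ S.subgroupOf H')))⁻¹ • τ ((q.out : ↥H') : N) w ≠ 0 := by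
    rw [hcomp]
    exact smul_ne_zero (Nat.cast_ne_zero.2 Fintype.card_ne_zero) hχ
  obtain ⟨χ', -, hχ'⟩ := Finset.exists_ne_zero_of_sum_ne_zero hne
  rw [hstep χ'] at hχ'
  obtain ⟨hscal, hχ'v⟩ := smul_ne_zero_iff.1 hχ'
  -- the scalar is non-zero only if `χ'` extends `χ`
  have hext : χ'.compAddMonoidHom (MonoidHom.toAdditive ι) = χ := by
    by_contra hne'
    rw [AddChar.sum_eq_ite, if_neg (sub_ne_zero.2 hne')] at hscal
    exact hscal rfl
  refine ⟨χ', fun x => ?_, hχ'v⟩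
  have h := congrArg (fun φ : AddChar (Additive (↥H ⧸ S.subgroupOf H)) ℂ => φ (Additive.ofMul (QuotientGroup.mk x : ↥H ⧸ S.subgroupOf H))) hext
  simpa only [AddChar.compAddMonoidHom_apply, MonoidHom.toAdditive_apply_apply, toMul_ofMul, hιmk] using h

end Algebra

/-! ## §2  The Jacquet–Langlands lemma in this currency: `v ∈ V(N, ψ)` ⇒ a deep twisted `ψ`-average of `v` vanishes -/

section JL

variable [TopologicalSpace N] [IsTopologicalGroup N]

/-- **JACQUET–LANGLANDS' LEMMA (one direction, finite-averaging form).**  `τ` smooth, `K₀ ≤ K₁ ≤ ⋯` compact subgroups exhausting `N`, `S` open, `ψ` trivial on `S`,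
`v` fixed by `S`, `v ∈ V(N, ψ) = Coinvariants.ker (τ.twist ψ⁻¹)` ⟹ `∑_{q ∈ Kₘ⧸S} ψ(q̃)⁻¹ τ(q̃) v = 0` for some `m` (`Kₘ` ∋ the group elements of a presentation of
`v`; `U := S ∩ ⋂ Stab(xᵢ)`, finite index in the compact `Kₘ`; the `U`-average kills `v` (§1) and the `S`-average of the `U`-average is `|Kₘ⧸U|` times the `S`-average).
[cite: BernsteinZelevinsky1976, §2.33] [cite: Bump1997, Prop. 4.4.1 p. 462] -/
theorem exists_twistedSum_eq_zero_of_mem_ker (hτ : τ.IsSmooth)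
    (K : ℕ → Subgroup N) (hKmono : Monotone K) (hKc : ∀ n, IsCompact (K n : Set N)) (hKcov : ∀ x, ∃ n, x ∈ K n)
    {S : Subgroup N} (hSo : IsOpen (S : Set N))
    (ψ : N →* ℂˣ) (hψS : ∀ s ∈ S, ψ s = 1) {v : V} (hSv : ∀ s ∈ S, τ s v = v)
    (hv : v ∈ Coinvariants.ker (τ.twist ψ⁻¹)) :
    ∃ m : ℕ, ∀ [Fintype (↥(K m) ⧸ S.subgroupOf (K m))],
      ∑ q : ↥(K m) ⧸ S.subgroupOf (K m), (((ψ ((q.out : ↥(K m)) : N) : ℂˣ) : ℂ))⁻¹ • τ ((q.out : ↥(K m)) : N) v = 0 := by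
  classical
  obtain ⟨c, hc⟩ := Finsupp.mem_span_range_iff_exists_finsupp.1 hv
  -- a level containing the group elements of the presentation
  choose idx hidx using fun p : N × V => hKcov p.1
  set m : ℕ := c.support.sup idx with hm
  have hmem : ∀ p ∈ c.support, p.1 ∈ K m := fun p hp => hKmono (Finset.le_sup hp) (hidx p)
  refine ⟨m, fun {inst} => ?_⟩
  haveI : CompactSpace ↥(K m) := isCompact_iff_compactSpace.1 (hKc m)
  set cψ : ↥(K m) → ℂ := fun x => ((ψ (x : N) : ℂˣ) : ℂ) with hcψ
  have hcmul : ∀ x y : ↥(K m), cψ (x * y) = cψ x * cψ y := fun x y => by simp only [hcψ, Subgroup.coe_mul, map_mul, Units.val_mul]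
  -- the deep subgroup `U`
  set U : Subgroup ↥(K m) := S.subgroupOf (K m) ⊓ ⨅ p : c.support, (τ.stabilizerSubgroup p.1.2).comap (K m).subtype with hU
  have hUo : IsOpen (U : Set ↥(K m)) := by
    rw [hU, Subgroup.coe_inf, Subgroup.coe_iInf]
    exact (hSo.preimage continuous_subtype_val).inter (isOpen_iInter_of_finite fun p => (hτ p.1.2).preimage continuous_subtype_val)
  haveI : Finite (↥(K m) ⧸ U) := Subgroup.quotient_finite_of_isOpen U hUo
  letI : Fintype (↥(K m) ⧸ U) := Fintype.ofFinite _
  have hUS : ∀ t ∈ U, (t : N) ∈ S := fun t ht => Subgroup.mem_subgroupOf.1 (Subgroup.mem_inf.1 ht).1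
  have hU1 : ∀ t ∈ U, cψ t = 1 := fun t ht => by simp only [hcψ, hψS _ (hUS t ht), Units.val_one]
  have hS1 : ∀ t ∈ S.subgroupOf (K m), cψ t = 1 := fun t ht => by simp only [hcψ, hψS _ (Subgroup.mem_subgroupOf.1 ht), Units.val_one]
  have hUp : ∀ p ∈ c.support, ∀ t ∈ U, τ ((t : ↥(K m)) : N) p.2 = p.2 := by
    intro p hp t ht
    have h := (Subgroup.mem_iInf.1 (Subgroup.mem_inf.1 ht).2) ⟨p, hp⟩
    simpa only [Subgroup.mem_comap, mem_stabilizerSubgroup, Subgroup.coe_subtype] using h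
  -- the `U`-level average as a linear map; it kills `v`
  set L : V →ₗ[ℂ] V := ∑ q : ↥(K m) ⧸ U, (cψ q.out)⁻¹ • τ ((q.out : ↥(K m)) : N) with hL
  have hLapply : ∀ x : V, L x = ∑ q : ↥(K m) ⧸ U, (cψ q.out)⁻¹ • τ ((q.out : ↥(K m)) : N) x := fun x => by
    simp only [hL, LinearMap.sum_apply, LinearMap.smul_apply]
  have hLgen : ∀ p ∈ c.support, L (τ.twist ψ⁻¹ p.1 p.2 - p.2) = 0 := by
    intro p hp
    have h := twistedSum_sub_eq_zero τ U cψ hcmul hU1 (hUp p hp) ⟨p.1, hmem p hp⟩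
    rw [hLapply, twist_apply, MonoidHom.inv_apply, Units.val_inv_eq_inv_val]
    exact h
  have hLv : L v = 0 := by
    rw [← hc, map_finsuppSum]
    exact Finset.sum_eq_zero fun p hp => by dsimp only; rw [map_smul, hLgen p hp, smul_zero]
  -- the `S`-level average of `L v` is `|Kₘ ⧸ U|` times the `S`-level average of `v`
  have hSv' : ∀ t ∈ S.subgroupOf (K m), τ ((t : ↥(K m)) : N) v = v := fun t ht => hSv _ (Subgroup.mem_subgroupOf.1 ht)
  have hEL : ∑ q : ↥(K m) ⧸ S.subgroupOf (K m), (cψ q.out)⁻¹ • τ ((q.out : ↥(K m)) : N) (L v) =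
      (Fintype.card (↥(K m) ⧸ U) : ℂ) • ∑ q : ↥(K m) ⧸ S.subgroupOf (K m), (cψ q.out)⁻¹ • τ ((q.out : ↥(K m)) : N) v := by
    rw [hLapply]; simp only [map_sum, map_smul, Finset.smul_sum]; rw [Finset.sum_comm]
    have h1 : ∀ p : ↥(K m) ⧸ U, ∑ q : ↥(K m) ⧸ S.subgroupOf (K m), (cψ q.out)⁻¹ • (cψ p.out)⁻¹ • τ ((q.out : ↥(K m)) : N) (τ ((p.out : ↥(K m)) : N) v) =
        ∑ q : ↥(K m) ⧸ S.subgroupOf (K m), (cψ q.out)⁻¹ • τ ((q.out : ↥(K m)) : N) v := by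
      intro p
      have h := twistedSum_translate τ (S.subgroupOf (K m)) cψ hcmul hS1 hSv' p.out
      simp_rw [smul_comm ((cψ _)⁻¹) ((cψ p.out)⁻¹)]
      rw [← Finset.smul_sum, h, smul_smul, inv_mul_cancel₀ (mulFun_ne_zero (S.subgroupOf (K m)) cψ hcmul hS1 p.out), one_smul]
    simp_rw [h1]; rw [Finset.sum_const, Finset.card_univ, ← Nat.cast_smul_eq_nsmul ℂ, ← Finset.smul_sum]
  rw [hLv] at hEL; simp only [map_zero, smul_zero, Finset.sum_const_zero] at hEL
  exact (smul_eq_zero.1 hEL.symm).resolve_left (Nat.cast_ne_zero.2 Fintype.card_ne_zero)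

end JL

/-! ## §3  The head: separation by twisted coinvariants -/

section Main

variable [TopologicalSpace N] [IsTopologicalGroup N]

/-- **LEV-1: SEPARATION BY TWISTED COINVARIANTS.**  `N` abelian, exhausted by compact open subgroups `K₀ ≤ K₁ ≤ ⋯`, `τ` smooth, `v` in the kernel
`V(N, ψ) = ⟨ψ(n)⁻¹τ(n)x − x⟩` of the `ψ`-twisted coinvariants for EVERY character `ψ : N → ℂ^×` with open kernel ⟹ `v = 0` (finite-averaging idempotents on the finite
abelian `Kₙ ⧸ (K₀ ∩ Stab v)` §1, a compatible thread of characters by dependent choice glued to a smooth character of `N = ⋃ Kₙ`, and the Jacquet–Langlands lemma §2).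
[cite: BernsteinZelevinsky1976, §2.33] [cite: BernsteinZelevinskyASENS1977, §1.8] [cite: Bump1997, Prop. 4.4.1 p. 462] -/
theorem eq_zero_of_forall_mem_ker_coinvariants_twist (hτ : τ.IsSmooth)
    (K : ℕ → Subgroup N) (hKmono : Monotone K) (hKo : ∀ n, IsOpen (K n : Set N)) (hKc : ∀ n, IsCompact (K n : Set N)) (hKcov : ∀ x, ∃ n, x ∈ K n)
    {v : V} (hv : ∀ ψ : N →* ℂˣ, IsOpen (ψ.ker : Set N) → v ∈ Coinvariants.ker (τ.twist ψ⁻¹)) : v = 0 := by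
  classical
  by_contra hv0
  -- the base subgroup `S = K₀ ∩ Stab v`
  set S : Subgroup N := K 0 ⊓ τ.stabilizerSubgroup v with hS
  have hSo : IsOpen (S : Set N) := by rw [hS, Subgroup.coe_inf]; exact (hKo 0).inter (hτ v)
  have hSK : ∀ n, S ≤ K n := fun n => inf_le_left.trans (hKmono (Nat.zero_le n))
  have hSv : ∀ s ∈ S, τ s v = v := fun s hs => (mem_stabilizerSubgroup τ v s).1 (Subgroup.mem_inf.1 hs).2
  -- the finite abelian quotients `Kₙ ⧸ S`
  have hfin : ∀ n, Finite (↥(K n) ⧸ S.subgroupOf (K n)) := fun n => by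
    haveI : CompactSpace ↥(K n) := isCompact_iff_compactSpace.1 (hKc n)
    exact Subgroup.quotient_finite_of_isOpen _ (hSo.preimage continuous_subtype_val)
  letI : ∀ n, Fintype (↥(K n) ⧸ S.subgroupOf (K n)) := fun n => Fintype.ofFinite _
  -- level `0`: some character has a non-zero twisted average (completeness)
  have h0 : ∃ χ : AddChar (Additive (↥(K 0) ⧸ S.subgroupOf (K 0))) ℂ,
      ∑ q : ↥(K 0) ⧸ S.subgroupOf (K 0), (χ (Additive.ofMul (QuotientGroup.mk q.out : ↥(K 0) ⧸ S.subgroupOf (K 0))))⁻¹ • τ ((q.out : ↥(K 0)) : N) v ≠ 0 := by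
    by_contra h; push Not at h
    have hc := sum_addChar_twistedSum_eq_card_smul τ (S.subgroupOf (K 0)) (w := v) fun t ht => hSv _ (Subgroup.mem_subgroupOf.1 ht)
    rw [Finset.sum_eq_zero fun χ _ => h χ] at hc
    exact hv0 ((smul_eq_zero.1 hc.symm).resolve_left (Nat.cast_ne_zero.2 Fintype.card_ne_zero))
  -- the extension step (orthogonality in stages)
  have hstep : ∀ (n : ℕ) (χ : AddChar (Additive (↥(K n) ⧸ S.subgroupOf (K n))) ℂ),
      ∑ q : ↥(K n) ⧸ S.subgroupOf (K n), (χ (Additive.ofMul (QuotientGroup.mk q.out : ↥(K n) ⧸ S.subgroupOf (K n))))⁻¹ • τ ((q.out : ↥(K n)) : N) v ≠ 0 →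
      ∃ χ' : AddChar (Additive (↥(K (n + 1)) ⧸ S.subgroupOf (K (n + 1)))) ℂ,
        (∀ x : ↥(K n), χ' (Additive.ofMul (QuotientGroup.mk (Subgroup.inclusion (hKmono (Nat.le_succ n)) x) : ↥(K (n + 1)) ⧸ S.subgroupOf (K (n + 1)))) =
          χ (Additive.ofMul (QuotientGroup.mk x : ↥(K n) ⧸ S.subgroupOf (K n)))) ∧
        ∑ q : ↥(K (n + 1)) ⧸ S.subgroupOf (K (n + 1)),
          (χ' (Additive.ofMul (QuotientGroup.mk q.out : ↥(K (n + 1)) ⧸ S.subgroupOf (K (n + 1)))))⁻¹ • τ ((q.out : ↥(K (n + 1))) : N) v ≠ 0 :=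
    fun n χ hχ => exists_addChar_extension τ (hKmono (Nat.le_succ n)) hSv χ hχ
  choose ext hext_compat hext_ne using hstep
  obtain ⟨χ₀, hχ₀⟩ := h0
  -- the thread (dependent choice)
  let th : (n : ℕ) → {χ : AddChar (Additive (↥(K n) ⧸ S.subgroupOf (K n))) ℂ //
      ∑ q : ↥(K n) ⧸ S.subgroupOf (K n), (χ (Additive.ofMul (QuotientGroup.mk q.out : ↥(K n) ⧸ S.subgroupOf (K n))))⁻¹ • τ ((q.out : ↥(K n)) : N) v ≠ 0} :=
    fun n => Nat.rec (motive := fun n => {χ : AddChar (Additive (↥(K n) ⧸ S.subgroupOf (K n))) ℂ //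
      ∑ q : ↥(K n) ⧸ S.subgroupOf (K n), (χ (Additive.ofMul (QuotientGroup.mk q.out : ↥(K n) ⧸ S.subgroupOf (K n))))⁻¹ • τ ((q.out : ↥(K n)) : N) v ≠ 0})
      ⟨χ₀, hχ₀⟩ (fun n ih => ⟨ext n ih.1 ih.2, hext_ne n ih.1 ih.2⟩) n
  -- compatibility along `n ≤ m` (one step is `hext_compat n (th n).1 (th n).2`)
  have hth_le : ∀ (x : N) (n m : ℕ) (hn : x ∈ K n) (hnm : n ≤ m),
      (th m).1 (Additive.ofMul (QuotientGroup.mk (⟨x, hKmono hnm hn⟩ : ↥(K m)) : ↥(K m) ⧸ S.subgroupOf (K m))) =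
        (th n).1 (Additive.ofMul (QuotientGroup.mk (⟨x, hn⟩ : ↥(K n)) : ↥(K n) ⧸ S.subgroupOf (K n))) := by
    intro x n m hn hnm
    induction m, hnm using Nat.le_induction with
    | base => rfl
    | succ m hle ih => rw [← ih]; exact hext_compat m (th m).1 (th m).2 ⟨x, hKmono hle hn⟩
  -- the glued character
  let idx : N → ℕ := fun x => Nat.find (hKcov x)
  have hidx : ∀ x, x ∈ K (idx x) := fun x => Nat.find_spec (hKcov x)
  have hidx_min : ∀ x m, x ∈ K m → idx x ≤ m := fun x m hm => Nat.find_min' (hKcov x) hm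
  let ψf : N → ℂ := fun x => (th (idx x)).1 (Additive.ofMul (QuotientGroup.mk (⟨x, hidx x⟩ : ↥(K (idx x))) : ↥(K (idx x)) ⧸ S.subgroupOf (K (idx x))))
  have hψf : ∀ (x : N) (m : ℕ) (hm : x ∈ K m),
      ψf x = (th m).1 (Additive.ofMul (QuotientGroup.mk (⟨x, hm⟩ : ↥(K m)) : ↥(K m) ⧸ S.subgroupOf (K m))) :=
    fun x m hm => (hth_le x (idx x) m (hidx x) (hidx_min x m hm)).symm
  have hψf_mul : ∀ x y, ψf (x * y) = ψf x * ψf y := by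
    intro x y
    set m : ℕ := max (max (idx x) (idx y)) (idx (x * y)) with hmdef
    have hx : x ∈ K m := hKmono ((le_max_left _ _).trans (le_max_left _ _)) (hidx x)
    have hy : y ∈ K m := hKmono ((le_max_right _ _).trans (le_max_left _ _)) (hidx y)
    have hxy : x * y ∈ K m := hKmono (le_max_right _ _) (hidx (x * y))
    rw [hψf x m hx, hψf y m hy, hψf (x * y) m hxy, ← AddChar.map_add_eq_mul, ← ofMul_mul, ← QuotientGroup.mk_mul]
    rfl
  have hψf_one : ψf 1 = 1 := by
    rw [hψf 1 0 (K 0).one_mem]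
    have h1 : (QuotientGroup.mk (⟨1, (K 0).one_mem⟩ : ↥(K 0)) : ↥(K 0) ⧸ S.subgroupOf (K 0)) = 1 := rfl
    rw [h1, ofMul_one, AddChar.map_zero_eq_one]
  let ψ₁ : N →* ℂ := { toFun := ψf, map_one' := hψf_one, map_mul' := hψf_mul }
  let ψ : N →* ℂˣ := ψ₁.toHomUnits
  have hψ_coe : ∀ x, ((ψ x : ℂˣ) : ℂ) = ψf x := fun x => rfl
  -- `S ≤ Ker ψ`, so `Ker ψ` is open
  have hψS : ∀ s ∈ S, ψ s = 1 := by
    intro s hs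
    ext
    rw [hψ_coe, hψf s 0 (hSK 0 hs), Units.val_one,
      (QuotientGroup.eq_one_iff (⟨s, hSK 0 hs⟩ : ↥(K 0))).2 (Subgroup.mem_subgroupOf.2 hs), ofMul_one, AddChar.map_zero_eq_one]
  have hψo : IsOpen (ψ.ker : Set N) := Subgroup.isOpen_mono (fun s hs => (MonoidHom.mem_ker).2 (hψS s hs)) hSo
  -- the hypothesis at `ψ`, and the Jacquet–Langlands lemma
  obtain ⟨m, hm⟩ := exists_twistedSum_eq_zero_of_mem_ker τ hτ K hKmono hKc hKcov hSo ψ hψS hSv (hv ψ hψo)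
  refine (th m).2 (Eq.trans (Finset.sum_congr rfl fun q _ => ?_) hm)
  rw [hψ_coe, hψf _ m q.out.2]

end Main

/-! ## §4  Corollaries in the consumers' frames: a commutative `Group`, and an abelian subgroup `U ≤ G` with `Representation.charTwist` -/

section Corollaries

/-- **LEV-1 for a `Group` with a commutativity hypothesis** (no `CommGroup` instance, e.g. `N = ↥U` for an abelian subgroup `U`). [cite: BernsteinZelevinsky1976, §2.33] -/
theorem eq_zero_of_forall_mem_ker_coinvariants_twist_of_comm {M : Type*} [Group M] [TopologicalSpace M] [IsTopologicalGroup M]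
    (hcomm : ∀ x y : M, x * y = y * x) {W : Type*} [AddCommGroup W] [Module ℂ W] (σ : Representation ℂ M W) (hσ : σ.IsSmooth)
    (K : ℕ → Subgroup M) (hKmono : Monotone K) (hKo : ∀ n, IsOpen (K n : Set M)) (hKc : ∀ n, IsCompact (K n : Set M)) (hKcov : ∀ x, ∃ n, x ∈ K n)
    {v : W} (hv : ∀ ψ : M →* ℂˣ, IsOpen (ψ.ker : Set M) → v ∈ Coinvariants.ker (σ.twist ψ⁻¹)) : v = 0 := by
  letI : CommGroup M := { (inferInstance : Group M) with mul_comm := hcomm }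
  exact eq_zero_of_forall_mem_ker_coinvariants_twist σ hσ K hKmono hKo hKc hKcov hv

/-- **LEV-1 FOR AN ABELIAN SUBGROUP `U ≤ G` IN THE `charTwist` CURRENCY** (the shape rule (lev) uses for the root subgroups `U_{α₁} ≅ F`, `U_Q ≅ F²` of `GL₃(F)`):
`ρ` smooth on `G`, `U ≤ G` abelian exhausted by subgroups `K₀ ≤ K₁ ≤ ⋯` compact and open IN `U`, `v` dying in `(ρ.charTwist U θ).Coinvariants` (★ `WhittakerTwistedJacquet`)
for EVERY character `θ : U → ℂ^×` with open kernel ⟹ `v = 0`. [cite: BernsteinZelevinsky1976, §2.33] [cite: BernsteinZelevinskyASENS1977, §1.8] -/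
theorem eq_zero_of_forall_mem_ker_charTwist {G : Type*} [Group G] [TopologicalSpace G] [IsTopologicalGroup G]
    {W : Type*} [AddCommGroup W] [Module ℂ W] (ρ : Representation ℂ G W) (hρ : ρ.IsSmooth)
    (U : Subgroup G) (hU : ∀ x y : ↥U, x * y = y * x)
    (K : ℕ → Subgroup ↥U) (hKmono : Monotone K) (hKo : ∀ n, IsOpen (K n : Set ↥U)) (hKc : ∀ n, IsCompact (K n : Set ↥U)) (hKcov : ∀ x, ∃ n, x ∈ K n)
    {v : W} (hv : ∀ θ : ↥U →* ℂˣ, IsOpen (θ.ker : Set ↥U) → v ∈ Coinvariants.ker (ρ.charTwist U θ)) : v = 0 := by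
  set σ : Representation ℂ ↥U W := ρ.comp U.subtype with hσdef
  have hsm : σ.IsSmooth := fun w => by
    have h : (σ.stabilizerSubgroup w : Set ↥U) = ((↑) : ↥U → G) ⁻¹' (ρ.stabilizerSubgroup w : Set G) := by
      ext x; simp only [SetLike.mem_coe, mem_stabilizerSubgroup, Set.mem_preimage, hσdef]; rfl
    show IsOpen (σ.stabilizerSubgroup w : Set ↥U)
    exact h ▸ (hρ w).preimage continuous_subtype_val
  exact eq_zero_of_forall_mem_ker_coinvariants_twist_of_comm hU σ hsm K hKmono hKo hKc hKcov hv

end Corollaries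

end Summit.HodgeConjecture.HodgeConjecture.Cruxes.H413.K2E3TwistedCoinvariantsSeparation

end
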